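import Literature.NumberTheory.DiophantineGeometry.NamedHypothesesRHProofs
import Literature.NumberTheory.LFunctions.ZeroCounting
import Literature.NumberTheory.LFunctions.RHConditionalFactsProofs
import Literature.Barriers.RiemannHypothesis.BoundedFluctuationCounting
import Literature.Barriers.RiemannHypothesis.GramRosserFailuresHolds
import Literature.Barriers.RiemannHypothesis.GramRosserFailuresProofs
import Literature.NumberTheory.LFunctions.LindelofBacklundNecessity
import Literature.NumberTheory.LFunctions.TuringMethod
import Literature.NumberTheory.LFunctions.ZetaGapRecordsRH
import Literature.NumberTheory.LFunctions.ZetaZerosProofs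
import Literature.NumberTheory.LFunctions.ZeroCountingDerivZetaProofs
import Summits.RiemannHypothesis.Statement
import HarnessLib

/-!
# Reference pins of the zero-counting jump: frame, jump machinery, and the VALID (trivial-direction) splittings (zd-neg g9 §§0–2)

Cell rh-split, seat rh-split-zd-neg g9 (brief sha16 f79c5f09d8bcb036), card `run/shared/lean/pub/rh-split/cards/SPLIT-zd-neg.md` GEN-9
(N62–N64, B10); source `HOME/rh-split-zd-neg/SketchG9r3.lean` sha16 baf56696ec23d90d §§0–6 (= `SketchG9.lean` 1de7f68b shifted), referee
rh-split-ref g4 REPLAY PASS 2026-08-27T07:55:17Z (rev.2) / 08:13:14Z (r3); lead rh-split-lead g3 lane (x-c), CARVE MAP in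
`HOME/rh-split-zd-neg/HANDOFF-g9.md`.  Filed by rh-split-typer-2 g4 as three files (`ZdReferencePinsFrame` §§0–2 → `ZdReferencePins` §3 →
`ZdReferencePinsExact` §§4–6), namespace `RhSplitZdNegG9` ↦ `…Splittings.ZdReferencePins`; deltas per the CARVE MAP conventions: the scratch
abbreviations `FIN` / `H₀` are SPELLED OUT (`riemannHypothesisUpTo_platt_trudgian` / `3000175332800`) and dropped, decl text otherwise byte-verbatim;
`RiemannHypothesis` is the summit's (`Summits.RiemannHypothesis.Statement`).

CONTENT (count side of the zd splitting search): «reference pins» — tails saying that the zero-counting jump `S(t) − S(t/2)` (or a windowed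
version) stays small above a height — are VALID splitting partners of FIN in the trivial direction (§2) but are REFUTED: §3 (N63) by the local gap
engine modulo the tree-NAMED fact `buiMilinovich2018_theorem11_critical` (hypothesis position), §4 (N64) the exact-ratio reference only extracts a
dyadic companion, §5–§6 shrinking windows/widths (B10 scope).  The UNCONDITIONAL refutation of every pin containing the half-height point is E2
(`ZdTwoHeightMeanSquare.lean`).  LABELS (referee g4): RH-FREE kernel bookkeeping / refutations; class (zd, neg) UNCHANGED = BARRIER NOTE, 0 survivors.

This file: §0 frame (`RHAbove`, `rh_of_fin_of_rhAbove`), §1 jump machinery (`two_le_count_jump`, two-height `zetaArgS_sub`), §2 N63 dyadic reference pins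
(`DyadicPinW`, `DyadicPin`; `rh_of_fin_of_dyadicPin(W)`).

HONEST LABEL: «SPLITTING SEARCH over kernel-typed RH-EQUIVALENCES; a splitting A ∧ B ⟹ RH is CONDITIONAL bookkeeping unless A and B are
both proved; nothing here bears on the truth of RH.»
-/

set_option linter.dupNamespace false

noncomputable section

open Filter Complex
open scoped Real Topology

namespace Summit.RiemannHypothesis.RiemannHypothesis.Theorems.Splittings.ZdReferencePins

open Literature.NumberTheory.DiophantineGeometry Literature.NumberTheory.LFunctions
  Literature.Barriers.RiemannHypothesis

/-! ## §0 Frame (verbatim from g0) -/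

/-- `RH above height H`: every zero of `ζ` with ordinate `> H` has real part `1/2`. -/
def RHAbove (H : ℝ) : Prop :=
  ∀ s : ℂ, riemannZeta s = 0 → H < s.im → s.re = 1 / 2

/-- The trivial splitting: `riemannHypothesisUpTo_platt_trudgian ∧ RHAbove 3000175332800 → RH`. -/
theorem rh_of_fin_of_rhAbove (hA : riemannHypothesisUpTo_platt_trudgian) (hB : RHAbove 3000175332800) : RiemannHypothesis := by
  refine riemannHypothesis_of_forall_riemannHypothesisUpTo_holds fun T s hs h0 _ ↦ ?_
  by_cases hle : s.im ≤ 3000175332800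
  · exact hA s hs h0 hle
  · exact hB s hs (lt_of_not_ge hle)

/-- Conversely RH gives `RHAbove H` for every `H ≥ 0`. -/
theorem rhAbove_of_rh (hRH : RiemannHypothesis) {H : ℝ} (hH : 0 ≤ H) : RHAbove H := by
  intro s hs hIm
  have h0 : 0 < s.im := hH.trans_lt hIm
  exact RiemannHypothesisUpTo.of_riemannHypothesis hRH s.im s hs h0 le_rfl

/-- `RHAbove` is monotone in the height. -/
theorem RHAbove.mono {H H' : ℝ} (hHH' : H ≤ H') (h : RHAbove H) : RHAbove H' :=
  fun s hs hIm ↦ h s hs (hHH'.trans_lt hIm)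

/-! ## §1 Jump machinery (`two_le_count_jump` verbatim from the g0 kernel; not in the tree) -/

/- Reflection `riemannZeta_one_sub_conj_eq_zero` (zero `1 − conj ρ` for `0 < Im ρ`) and the strip
lemma `re_mem_Ioo_of_riemannZeta_eq_zero_of_im_ne_zero` are CITED from the tree
(`ZeroCountingDerivZetaProofs`, `ZetaZerosProofs`), not restated (lead 07:16:47Z). -/

/-- Two distinct zeros with the same ordinate `γ > 0` make `N` jump by at least `2` across `γ`. -/
theorem two_le_count_jump {s s' : ℂ} (hs : riemannZeta s = 0) (hs' : riemannZeta s' = 0)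
    (hne : s ≠ s') (him : s'.im = s.im) (h0 : 0 < s.im)
    (hre : 0 ≤ s.re ∧ s.re ≤ 1) (hre' : 0 ≤ s'.re ∧ s'.re ≤ 1) {t : ℝ} (ht : t < s.im) :
    (2 : ℝ) ≤ (zetaZeroCount s.im : ℝ) - zetaZeroCount t := by
  classical
  unfold zetaZeroCount
  rw [zetaZeroCountRe_sub_eq_sum 0 ht.le]
  have hmem : ∀ u : ℂ, riemannZeta u = 0 → (0 ≤ u.re ∧ u.re ≤ 1) → u.im = s.im →
      u ∈ (zetaZeroBox_finite 0 s.im).toFinset \ (zetaZeroBox_finite 0 t).toFinset := by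
    intro u hu hure huim
    rw [Finset.mem_sdiff, Set.Finite.mem_toFinset, Set.Finite.mem_toFinset]
    refine ⟨⟨hu, hure.1, hure.2, by rw [huim]; exact h0, le_of_eq huim⟩, ?_⟩
    rintro ⟨-, -, -, -, h5⟩
    rw [huim] at h5
    exact absurd h5 (not_le.2 ht)
  have hsub : ({s, s'} : Finset ℂ) ⊆
      (zetaZeroBox_finite 0 s.im).toFinset \ (zetaZeroBox_finite 0 t).toFinset := by
    intro u hu
    rw [Finset.mem_insert, Finset.mem_singleton] at hu
    rcases hu with rfl | rfl
    · exact hmem _ hs hre rfl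
    · exact hmem _ hs' hre' him
  have hpos : ∀ u : ℂ, riemannZeta u = 0 → (1 : ℝ) ≤ (riemannZetaZeroOrder u : ℝ) := by
    intro u hu
    have h1 : (1 : ℤ) ≤ riemannZetaZeroOrder u := by
      have := (riemannZetaZeroOrder_pos_iff (ne_one_of_riemannZeta_eq_zero hu)).2 hu
      omega
    exact_mod_cast h1
  calc (2 : ℝ) = 1 + 1 := by norm_num
    _ ≤ (riemannZetaZeroOrder s : ℝ) + (riemannZetaZeroOrder s' : ℝ) :=
        add_le_add (hpos s hs) (hpos s' hs')
    _ = ∑ u ∈ ({s, s'} : Finset ℂ), (riemannZetaZeroOrder u : ℝ) := by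
        rw [Finset.sum_pair hne]
    _ ≤ ∑ ρ ∈ (zetaZeroBox_finite 0 s.im).toFinset \ (zetaZeroBox_finite 0 t).toFinset,
          (riemannZetaZeroOrder ρ : ℝ) :=
        Finset.sum_le_sum_of_subset_of_nonneg hsub fun u hu _ ↦ Int.cast_nonneg
          (riemannZetaZeroOrder_nonneg (ne_one_of_riemannZeta_eq_zero (mem_sdiff_zetaZeroBox hu).1))

/-- The backbone of every jump argument: `S(t₂) − S(t₁) = [N(t₂) − N(t₁)] − [θ(t₂) − θ(t₁)]/π`. -/
theorem zetaArgS_sub (t₁ t₂ : ℝ) :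
    zetaArgS t₂ - zetaArgS t₁ = ((zetaZeroCount t₂ : ℝ) - zetaZeroCount t₁)
      - (riemannSiegelTheta t₂ - riemannSiegelTheta t₁) / π := by
  simp only [zetaArgS]
  ring

/-! ## §2 N63: dyadic reference pins — VALID splittings for radius `≤ 1` and any positive width -/

/-- `DyadicPinW H r w`: for every height `t ≥ H` and every reference height `u` in the window
`[t/2, t/2 + w t]` at half height, `|S(t) − S(u)| < r`. (N63 is `r = 1`, `w ≡ 1`.) -/
def DyadicPinW (H r : ℝ) (w : ℝ → ℝ) : Prop :=
  ∀ t u : ℝ, H ≤ t → t / 2 ≤ u → u ≤ t / 2 + w t → |zetaArgS t - zetaArgS u| < r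

/-- N63 proper: radius `1`, width `1`. -/
def DyadicPin (H : ℝ) : Prop := DyadicPinW H 1 fun _ ↦ 1

/-- Monotonicity in the radius and the height. -/
theorem DyadicPinW.mono {H H' r r' : ℝ} {w : ℝ → ℝ} (hH : H ≤ H') (hr : r ≤ r')
    (h : DyadicPinW H r w) : DyadicPinW H' r' w :=
  fun t u ht hu hu' ↦ (h t u (hH.trans ht) hu hu').trans_le hr

/-- **Jump principle with a common reference.** For radius `r ≤ 1` and a positive width that does
not increase on `[H, ∞)`, `DyadicPinW H r w → RHAbove H` (`H ≥ 0`): at an off-line ordinate `γ > H`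
the reference `u₀ = γ/2 + w(γ)/2` serves both `t = γ` and `t = γ − δ` (`δ ≤ w γ`), and
`S(γ) − S(γ − δ) → N`-jump `≥ 2` cannot fit inside the open interval `(S u₀ − r, S u₀ + r)`. -/
theorem rhAbove_of_dyadicPinW {H r : ℝ} {w : ℝ → ℝ} (hH : 0 ≤ H) (hr : r ≤ 1)
    (hw : AntitoneOn w (Set.Ici H)) (hwpos : ∀ t, H ≤ t → 0 < w t) (h : DyadicPinW H r w) :
    RHAbove H := by
  have h1 : DyadicPinW H 1 w := h.mono le_rfl hr
  intro s hs hIm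
  by_contra hre
  have h0 : 0 < s.im := hH.trans_lt hIm
  have him : s.im ≠ 0 := h0.ne'
  have hs' : riemannZeta (1 - starRingEnd ℂ s) = 0 := riemannZeta_one_sub_conj_eq_zero hs h0
  have him' : (1 - starRingEnd ℂ s).im = s.im := by simp
  have hres' : (1 - starRingEnd ℂ s).re = 1 - s.re := by simp
  have hne : s ≠ 1 - starRingEnd ℂ s := by
    intro hss
    apply hre
    have := congrArg Complex.re hss
    rw [hres'] at this
    linarith
  have hstrip := re_mem_Ioo_of_riemannZeta_eq_zero_of_im_ne_zero hs him
  have hwγ : 0 < w s.im := hwpos s.im hIm.le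
  -- the common reference point
  obtain ⟨u₀, hu₀⟩ : ∃ u₀ : ℝ, u₀ = s.im / 2 + w s.im / 2 := ⟨_, rfl⟩
  -- at height `γ`: `S(γ) < S(u₀) + 1`, margin `κ > 0`
  have hSγ := (abs_lt.1 (h1 s.im u₀ hIm.le (by rw [hu₀]; linarith) (by rw [hu₀]; linarith))).2
  obtain ⟨κ, hκ⟩ : ∃ κ : ℝ, κ = zetaArgS u₀ + 1 - zetaArgS s.im := ⟨_, rfl⟩
  have hκpos : 0 < κ := by linarith
  -- continuity of `θ` at `γ`
  obtain ⟨δ₀, hδ₀, hθ⟩ :=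
    Metric.continuous_iff.1 continuous_riemannSiegelTheta s.im (π * κ) (by positivity)
  obtain ⟨δ, hδpos, hδ₁, hδ₂, hδw⟩ : ∃ δ : ℝ, 0 < δ ∧ δ < δ₀ ∧ H ≤ s.im - δ ∧ δ ≤ w s.im := by
    refine ⟨min (min (δ₀ / 2) ((s.im - H) / 2)) (w s.im), ?_, ?_, ?_, min_le_right _ _⟩
    · exact lt_min (lt_min (by linarith) (by linarith)) hwγ
    · have := (min_le_left (min (δ₀ / 2) ((s.im - H) / 2)) (w s.im)).trans
        (min_le_left (δ₀ / 2) ((s.im - H) / 2))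
      linarith
    · have := (min_le_left (min (δ₀ / 2) ((s.im - H) / 2)) (w s.im)).trans
        (min_le_right (δ₀ / 2) ((s.im - H) / 2))
      linarith
  -- the width does not shrink when going down to `γ − δ`
  have hwδ : w s.im ≤ w (s.im - δ) := hw hδ₂ hIm.le (by linarith)
  -- at height `γ − δ` with the SAME reference: `S(γ − δ) > S(u₀) − 1`
  have hSt := (abs_lt.1 (h1 (s.im - δ) u₀ hδ₂ (by rw [hu₀]; linarith) (by rw [hu₀]; linarith))).1
  -- the jump of `N` across `γ`
  have hjump := two_le_count_jump hs hs' hne him' h0 ⟨hstrip.1.le, hstrip.2.le⟩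
    ⟨by rw [hres']; linarith [hstrip.2], by rw [hres']; linarith [hstrip.1]⟩
    (t := s.im - δ) (by linarith)
  -- the variation of `θ`
  have hd : dist (s.im - δ) s.im < δ₀ := by
    rw [Real.dist_eq, show s.im - δ - s.im = -δ by ring, abs_neg, abs_of_pos hδpos]
    exact hδ₁
  have hθv := hθ (s.im - δ) hd
  rw [Real.dist_eq] at hθv
  have hθv' := (abs_lt.1 hθv).1
  have hX : (riemannSiegelTheta s.im - riemannSiegelTheta (s.im - δ)) / π < κ := by
    rw [div_lt_iff₀ Real.pi_pos]
    linarith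
  have key := zetaArgS_sub (s.im - δ) s.im
  linarith

/-- N63: `DyadicPin H → RHAbove H` (`H ≥ 0`). -/
theorem rhAbove_of_dyadicPin {H : ℝ} (hH : 0 ≤ H) (h : DyadicPin H) : RHAbove H :=
  rhAbove_of_dyadicPinW (w := fun _ ↦ 1) hH le_rfl (fun _ _ _ _ _ ↦ le_rfl)
    (fun _ _ ↦ one_pos) h

/-- N63 is a VALID splitting partner of `riemannHypothesisUpTo_platt_trudgian` (non-vacuously: by the jump principle). -/
theorem rh_of_fin_of_dyadicPin (hA : riemannHypothesisUpTo_platt_trudgian) (hB : DyadicPin 3000175332800) : RiemannHypothesis :=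
  rh_of_fin_of_rhAbove hA (rhAbove_of_dyadicPin (by norm_num) hB)

/-- More generally every pin of radius `≤ 1` and constant width `w₀ > 0` splits with `riemannHypothesisUpTo_platt_trudgian`. -/
theorem rh_of_fin_of_dyadicPinW {r w₀ : ℝ} (hr : r ≤ 1) (hw₀ : 0 < w₀) (hA : riemannHypothesisUpTo_platt_trudgian)
    (hB : DyadicPinW 3000175332800 r fun _ ↦ w₀) : RiemannHypothesis :=
  rh_of_fin_of_rhAbove hA (rhAbove_of_dyadicPinW (by norm_num) hr (fun _ _ _ _ _ ↦ le_rfl)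
    (fun _ _ ↦ hw₀) hB)

end Summit.RiemannHypothesis.RiemannHypothesis.Theorems.Splittings.ZdReferencePins

end
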